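import Literature.AnabelianGeometry.EtaleTheta.GalSectCuspPairTorsors
import Literature.AnabelianGeometry.EtaleTheta.GalSectIntegralStructures
import HarnessLib

/-!
# [EtTh] Thm. 1.10 (iii) re-typed over the [GalSect] Def. 4.1 cuspidal-pair vocabulary

Mochizuki, *The étale theta function …* [EtTh], Publ. RIMS **45** (2009), Thm. 1.10 (iii) p.256 (PRIMS
PDF p.30) [cite: MochizukiEtTh2009, Thm 1.10 (iii) p.30]; [GalSect] = Mochizuki, *Galois sections in
absolute anabelian geometry*, Nagoya Math. J. **179** (2005), Def. 4.1 [cite: MochizukiGalSect2005, Def 4.1 p.33].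
abc-iut cell, layer L2, ROW (C) «EtTh:Thm1.10(iii) re-typed over the GalSect Def 4.1 vocabulary»
(abc-iut-L2-lead gen 3, RULINGS/ROWS #1 (R3), 2026-08-26T04:01:23Z; first refusal of the fact's holder
abc-iut-L2-t1 lapsed 04:11Z; seat abc-iut-w5-d062 gen 2).  STATEMENTS-FIRST; no named fact (the residual
[GalSect] Cor. 4.12 is `GalSect.GalSectCor412`, GAP-LEDGER G-w5d062-1).

**Thm. 1.10 (iii) (verbatim).** "Suppose that `η̈^{Θ,Z}_□` is of standard type, and that the residue
characteristic of `K_□` is odd. Then `η̈^{Θ,Z}_□` determines a `{±1}`-structure [cf. [Mzk13], Corollary 4.12;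
Remark 1.10.1, (ii), below] on the `(K^×_□)^∧`-torsor at the unique cusp of `Ċ^log_□` that is compatible
with the canonical integral structure and, moreover, preserved by `γ`."

What changes with respect to `Thm110iii` of `GalSectIntegralStructures.lean` (ROW (A), p419967, which
stays as landed): there the torsor at the cusp of `Ċ` was a bespoke datum `MuTwoSetting.DotCCuspTorsor`
(abstract class set `Cls`); here it is the GENERAL [GalSect] Def. 4.1 carrier of ROW (B) —
a `GalSect.CuspPair` `(D, I)` in `Π^tp_C` with `D ≤ Π^tp_Ċ` over the cusp `x` of `X`, its REAL torsor set
`CuspPair.SplittingClass` (splittings modulo `I`-conjugation), a `CuspPair.TorsorData` with structure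
group the REAL `(K^×)^∧ = GalSect.KxHat` of ROW (A) (`K = K̈` for a `MuTwoSetting`, Def. 1.7 (I)), the
`{±1}`-structure as `IsSubStructure` for `B = μ₂(K)` (`GalSect.rootsOfUnityK _ 2` mapped into `(K^×)^∧`),
and "preserved by `γ`" through `CuspPair.PreservedBy` along the extension `Γ` of `γ` to `Π^tp_C`
(`Thm110Hypothesis.Γ`, Prop. 1.8) corrected by the inner automorphism `Γ` is only defined up to.  DATA (no
carrier in `MuTwoSetting`): the cusp pair itself (the inertia needs the augmentation of `Π^tp_C`, which
`MuTwoSetting` does not carry — recorded as the field `augC` with its law), the torsor action, the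
canonical integral structure.  **v2 (13:00Z structure window, GAP-LEDGER G-w5d062-2)**: (a) the LAW that
the canonical integral structure is an `O_K^×`-structure ([GalSect] Def. 4.1 (iii); audit F-w5d016-g3-1:
without it the `∃`-shaped v1 typing is refutable at `canonical := ∅`); (b) the `{±1}`-structure
"DETERMINED BY `η̈^{Θ,Z}`" as DATA with its law, and the re-typed statement `Thm110iiiEta` (structures
fixed before `γ`, preservation for arbitrary `γ`) next to the v1 `Thm110iiiGalSect` (kept; it is the
`∃`-weakening, cf. `GalSectThm110iiiTransport.lean`); (c) the topological clauses of the cusp pair (`D`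
closed, `I ≅ Ẑ`) that the END-KNIT at the genuine `H¹`-torsor (`GalSectThm110iiiEndKnit.lean`) had to carry as
binders.  HONEST FRAMING: nothing printed is asserted;
typed ≠ proved; no side taken on [IUTchIII] Cor. 3.12, on which nothing here bears.
-/

noncomputable section

open scoped Pointwise

namespace Literature.AnabelianGeometry.EtaleTheta

open Literature.AnabelianGeometry.SemiGraphs

namespace MuTwoSetting

variable {p : ℕ} [Fact p.Prime] (M : MuTwoSetting p)

/-- The inner automorphism of `Π^tp_C` by `c`, as an isomorphism of topological groups (the "inner
automorphism" `Γ` is defined up to, `Thm110Hypothesis.restricts`). [cite: MochizukiEtTh2009, Prop 1.8 p.28] -/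
def innerAutC (c : M.GtpC) : M.GtpC ≃ₜ* M.GtpC :=
  { MulAut.conj c with
    continuous_toFun := by
      change Continuous fun h => c * h * c⁻¹
      fun_prop
    continuous_invFun := by
      change Continuous fun h => c⁻¹ * h * c
      fun_prop }

/-- **The cusp of `Ċ^log` through the [GalSect] Def. 4.1 carrier** ([EtTh] Thm. 1.10 (iii); `Ċ = Ẋ/⟨ε_± ε_μ⟩`
of type `(1, μ₂)±`, Def. 1.7): the augmentation `Π^tp_C → G_{ℚ_p}` extending that of `Π^tp_X` (`C` is
defined over `K`; NOT a field of `MuTwoSetting`), the cuspidal pair `(D, I)` of the unique cusp —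
`D ≤ Π^tp_Ċ`, `I = D ∩ Ker(augC)`, meeting `Π^tp_X` in a conjugate of `(D_x, I_x)` for a cusp `x` of `X` —
its torsor structure over the REAL `(K^×)^∧` and its canonical integral structure ([GalSect] §4, Def. 4.1
(iii)).  DATA. [cite: MochizukiEtTh2009, Thm 1.10 (iii) p.30] -/
structure DotCCusp (εZ : M.GtpC) : Type where
  /-- `Π^tp_C → G_{ℚ_p}` … -/
  augC : M.GtpC →* GQp p
  /-- … extending the augmentation of `Π^tp_X` -/
  augC_inclX : ∀ g : M.PiTemp, augC (M.inclX g) = M.aug g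
  /-- the cuspidal pair `(D, I)` of the cusp of `Ċ` in `Π^tp_C` -/
  pair : GalSect.CuspPair M.GtpC
  /-- `D ≤ Π^tp_Ċ` -/
  D_le : pair.D ≤ M.dotC εZ
  /-- `I = D ∩ Δ^tp_C` -/
  I_eq : pair.I = pair.D ⊓ augC.ker
  /-- the cusp `x` of `X` below and the conjugating element: `D ∩ Π^tp_X = g·D_x·g⁻¹` -/
  cusp : M.Pt
  cusp_isCusp : M.IsCusp cusp
  conj : M.PiTemp
  D_inf_range : pair.D ⊓ M.inclX.range = (MulAut.conj conj • M.decomp cusp).map M.inclX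
  /-- `D` is CLOSED in `Π^tp_C` (v2 topological clause: decomposition groups are closed, as L3's
  `TemperedCurve.isClosed_decomp`) -/
  isClosed_D : IsClosed (pair.D : Set M.GtpC)
  /-- `I ≅ Ẑ` (`= Ẑ(1)`: the inertia group at the cusp of `Ċ` is procyclic, hence compact and abelian; v2
  topological clause parallel to L3's `TemperedCurve.inertia_equiv_zHat`). [cite: MochizukiGalSect2005, §4 p.33] -/
  inertia_equiv_zHat : Nonempty (pair.I ≃ₜ* ZHat)
  /-- the `(K^×)^∧`-torsor structure on the splitting classes of `(D, I)` ([GalSect] §4) -/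
  torsor : pair.TorsorData (GalSect.KxHat M.toThetaSetting.toTemperedCurve)
  /-- the canonical integral structure at the cusp ([GalSect] Def. 4.1 (iii)), a set of classes -/
  canonical : Set pair.SplittingClass
  /-- … which is an `O_K^×`-STRUCTURE (v2 LAW, [GalSect] Def. 4.1 (iii); audit F-w5d016-g3-1) -/
  canonical_isStructure :
    torsor.IsStructure (GalSect.unitsHat M.toThetaSetting.toTemperedCurve) canonical
  /-- "the `{±1}`-structure DETERMINED BY `η̈^{Θ,Z}`" (v2; print: the `μ₂`-orbit of the splitting class
  given by the leading term of `Θ̈` at the cusp, a nonzero cotangent vector up to `±1`, [GalSect] §4 p.33)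
  — DATA, fixed before any `γ`; WHICH orbit it is (its origin in `η̈^{Θ,Z}`) has no carrier here and is
  certified only through an ORIGIN CLAUSE at the consumer (so the `∀`-closure of `Thm110iiiEta` over this
  free datum is NOT print's claim — exactly as for `canonical`, audit F-w5d016-g3-1) … -/
  etaStructure : Set pair.SplittingClass
  /-- … which is a `μ₂(K)`-structure (v2 LAW; `μ₂(K) ⊆ (K^×)^∧` spelled out = `muTwoHat` below). -/
  etaStructure_isStructure :
    torsor.IsStructure ((GalSect.rootsOfUnityK M.toThetaSetting.toTemperedCurve 2).map
      (GalSect.toKxHat M.toThetaSetting.toTemperedCurve)) etaStructure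

/-- `μ₂(K) = {±1} ⊆ (K^×)^∧` (`K = K̈`). [cite: MochizukiEtTh2009, Thm 1.10 (iii) p.30] -/
def muTwoHat : Subgroup (GalSect.KxHat M.toThetaSetting.toTemperedCurve) :=
  (GalSect.rootsOfUnityK M.toThetaSetting.toTemperedCurve 2).map
    (GalSect.toKxHat M.toThetaSetting.toTemperedCurve)

end MuTwoSetting

section Thm110iii

variable {p : ℕ} [Fact p.Prime] {Mα Mβ : MuTwoSetting p} {εα : Mα.GtpC} {εβ : Mβ.GtpC}
  {hCα : Mα.toThetaSetting.Compat} {hCβ : Mβ.toThetaSetting.Compat}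
  {Eα : Mα.toThetaSetting.EtaleThetaData} {Eβ : Mβ.toThetaSetting.EtaleThetaData}
  {γ : Mα.dotC εα ≃ₜ* Mβ.dotC εβ}

/-- **[EtTh] Thm. 1.10 (iii) over the [GalSect] Def. 4.1 carrier** (ROW (C); companion of `Thm110iii`):
for `p` odd and both `η̈^{Θ,Z}_□` of standard type, there are `{±1}`-structures `Rα`, `Rβ` on the
`(K^×_□)^∧`-torsors at the cusps of `Ċ^log_α`, `Ċ^log_β` (`μ₂(K_□)`-orbits of splitting classes) compatible
with the canonical integral structures, and the extension `Γ` of `γ` to `Π^tp_C` (Prop. 1.8), corrected by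
the inner automorphism by `c ∈ Π^tp_{Ċβ}` it is defined up to, carries the cusp pair and the member
splittings of `Rα` onto those of `Rβ` ("preserved by `γ`").  [cite: MochizukiEtTh2009, Thm 1.10 (iii) p.30] -/
def Thm110iiiGalSect (H : Thm110Hypothesis εα εβ hCα hCβ Eα Eβ γ)
    (Sα : Mα.StandardData Eα.toKummerData) (Sβ : Mβ.StandardData Eβ.toKummerData)
    (Cα : Mα.DotCCusp εα) (Cβ : Mβ.DotCCusp εβ) : Prop :=
  Odd p → Mα.IsOfStandardType hCα εα Sα Eα.etaDd → Mβ.IsOfStandardType hCβ εβ Sβ Eβ.etaDd →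
    ∃ (Rα : Set Cα.pair.SplittingClass) (Rβ : Set Cβ.pair.SplittingClass),
      Cα.torsor.IsSubStructure Mα.muTwoHat Cα.canonical Rα ∧
      Cβ.torsor.IsSubStructure Mβ.muTwoHat Cβ.canonical Rβ ∧
      ∃ c : Mβ.GtpC, c ∈ Mβ.dotC εβ ∧
        Cα.pair.PreservedBy Cβ.pair (H.Γ.trans (Mβ.innerAutC c)) Rα Rβ

/-- **[EtTh] Thm. 1.10 (iii), v2 typing (NOT `∃`-shaped)**: "`η̈^{Θ,Z}` DETERMINES a `{±1}`-structure … that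
is compatible with the canonical integral structure and, moreover, preserved by [arbitrary] `γ`" — the
`η̈`-determined structures are DATA of the cusp records (fixed before `γ`); the statement: for `p` odd and
both orbits of standard type, each lies inside the canonical integral structure, and the extension `Γ` of
`γ` (corrected by an inner automorphism of `Π^tp_{Ċβ}`) carries the one onto the other — for EVERY
hypothesis structure `H`, i.e. for arbitrary `γ`.  (The v1 typing `Thm110iiiGalSect` is its `∃`-weakening:
`GalSectThm110iiiTransport.lean`.)  CONSUMPTION RULE: at cusp data whose `etaStructure` satisfies an origin
clause tying it to `η̈^{Θ,Z}` (never as a `∀`-closure over the free data fields).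
[cite: MochizukiEtTh2009, Thm 1.10 (iii) p.30] -/
def Thm110iiiEta (H : Thm110Hypothesis εα εβ hCα hCβ Eα Eβ γ)
    (Sα : Mα.StandardData Eα.toKummerData) (Sβ : Mβ.StandardData Eβ.toKummerData)
    (Cα : Mα.DotCCusp εα) (Cβ : Mβ.DotCCusp εβ) : Prop :=
  Odd p → Mα.IsOfStandardType hCα εα Sα Eα.etaDd → Mβ.IsOfStandardType hCβ εβ Sβ Eβ.etaDd →
    Cα.etaStructure ⊆ Cα.canonical ∧ Cβ.etaStructure ⊆ Cβ.canonical ∧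
      ∃ c : Mβ.GtpC, c ∈ Mβ.dotC εβ ∧
        Cα.pair.PreservedBy Cβ.pair (H.Γ.trans (Mβ.innerAutC c)) Cα.etaStructure Cβ.etaStructure

end Thm110iii

end Literature.AnabelianGeometry.EtaleTheta

end
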